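import Literature.InformationTheory.QuantumCodes.MatchingDecoders
import Literature.InformationTheory.QuantumCodes.CSSPhenomenologicalThreshold
import HarnessLib

/-!
# Matching decoders with a boundary: every check matrix with column weights `≤ 2` is graphlike up to one
# virtual boundary check, and MWPM on the extended graph is minimum-weight decoding

Topic `Literature/InformationTheory/QuantumCodes` (venture QEC, LADDER-QEC Q5 «toric/SURFACE + MWPM»; qec-type-09
gen 4). Companion of `MatchingDecoders.lean` (Edmonds–Johnson / Korte–Vygen Thm 12.9 for graphlike syndrome maps:
every fault flips exactly the two ends of a link). Codes WITH BOUNDARIES (planar / surface codes, repetition codes,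
their space-time versions) have faults that flip a SINGLE check (a link dangling into the boundary). The standard
device — used by every surface-code matching decoder — is one VIRTUAL BOUNDARY CHECK `none : Option R` at which all
dangling links end; its (unmeasured) parity is determined by the measured ones, because the total boundary of a chain
vanishes ("for each connected component `C` of `G` we have that `Σ_{v ∈ V(C)} |J ∩ δ(v)| = 2|J ∩ E(C)|`",
Korte–Vygen Prop 12.6, proof). Contents (all PROVED, 0 facts, kernel axioms):

* `IsGraphlikeVia H ι` — the check matrix `H : Matrix R Q ℤ₂` is the restriction to the real checks `some r` of
  the incidence matrix of `ι : Q → Sym2 (Option R)`; `exists_isGraphlikeVia_of_card_colSupp_le_two` — EVERY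
  matrix whose columns have at most two non-zero entries is of this form;
* `graphSyn_none_eq_sum` (handshake: the virtual check's parity is the sum of the real syndrome bits),
  `extendSyn`, `extendSyn_mulVec : extendSyn (H *ᵥ e) = graphSyn ι e`;
* `boundaryDecoder D'` — run a decoder of the extended graph on the extended syndrome — and
  **`isMinWeight_boundaryDecoder`**: if `D'` is a matching decoder (`IsMatchingDecoder m D'`, any link metric on
  `Option R`, any tie-break, any geodesics) then `boundaryDecoder D'` is a minimum-weight decoder for `H`:
  `IsMinWeight (H *ᵥ ·) {x | H *ᵥ x = 0} hammingNorm` — the hypothesis of the tree's CSS-sector threshold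
  theorems (`PlanarSurfaceCodeThresholds`, `CSSCodeCapacityThreshold`, …);
* `stEndsOf ι T` and **`isGraphlikeVia_stMatrix`** — `T` rounds of noisy measurement: the space-time matrix
  `CSSPhenom.stMatrix H T` (`CSSPhenomenologicalThreshold.lean`) of a graphlike-with-boundary `H` is again
  graphlike with boundary (qubit faults in slice `t` keep their ends, measurement faults join `(c,t)`–`(c,t+1)`),
  so SPACE-TIME MWPM with a boundary is minimum-weight for `CSSPhenom.stSyn H T` (`isMinWeight_boundaryDecoder_st`).

## References
* [KorteVygen2002] B. Korte, J. Vygen, *Combinatorial Optimization*, 2nd ed., Springer (2002), §12.2 Prop 12.6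
  (proof: Σ_v |J ∩ δ(v)| = 2|J ∩ E(C)|) and Thm 12.9 (Edmonds–Johnson), pp. 276–277.
* [DennisEtAl2002] E. Dennis, A. Kitaev, A. Landahl, J. Preskill, *Topological quantum memory*, J. Math. Phys. 43
  (2002) 4452–4505, arXiv:quant-ph/0110143, §3.2 (planar codes: rough and smooth edges, chains ending at the boundary)
  and §4.4 p. 18.
-/

namespace Literature.InformationTheory.QuantumCodes

open Finset Matrix Literature.Barriers.PneNP

variable {R Q : Type*}

section Boundary

variable [Fintype R] [DecidableEq R] [Fintype Q]

/-- **`H` is graphlike with boundary via `ι`**: every column `q` of the check matrix is the indicator of the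
REAL ends of the link `ι q : Sym2 (Option R)` (`none` = the virtual boundary check). (definition)
[cite: DennisEtAl2002, §3.2 (links at the rough edge have a single site end)] -/
def IsGraphlikeVia (H : Matrix R Q (ZMod 2)) (ι : Q → Sym2 (Option R)) : Prop :=
  ∀ r q, H r q = pairIndicator (ι q) (some r)

variable {H : Matrix R Q (ZMod 2)} {ι : Q → Sym2 (Option R)}

omit [Fintype R] in
/-- The measured syndrome is the extended boundary read at the real checks. [cite: DennisEtAl2002, §3.2 and §4.3 (∂E)] -/
theorem mulVec_apply_eq_graphSyn_some (h : IsGraphlikeVia H ι) (e : Q → ZMod 2) (r : R) :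
    (H *ᵥ e) r = graphSyn ι e (some r) := by
  simp only [graphSyn, incMatrix, mulVec, dotProduct, of_apply]
  exact Finset.sum_congr rfl fun x _ => by rw [h r x]

/-- **Handshake**: the total boundary of any chain vanishes, `Σ_x ∂e(x) = 0` (every link contributes `1 + 1`).
[cite: KorteVygen2002, §12.2 proof of Prop 12.6 (Σ_{v} |J ∩ δ(v)| = 2|J ∩ E(C)|)] -/
theorem sum_graphSyn_eq_zero {V E : Type*} [Fintype V] [DecidableEq V] [Fintype E] (κ : E → Sym2 V)
    (e : E → ZMod 2) : ∑ x, graphSyn κ e x = 0 := by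
  simp only [graphSyn, mulVec, dotProduct, incMatrix, of_apply]
  rw [Finset.sum_comm]
  refine Finset.sum_eq_zero fun q _ => ?_
  rw [← Finset.sum_mul]
  suffices h : ∑ x, pairIndicator (κ q) x = 0 by rw [h, zero_mul]
  induction κ q using Sym2.ind with
  | h a b =>
    simp only [pairIndicator_mk, Pi.add_apply, sum_add_distrib, Finset.sum_pi_single', mem_univ, if_true]
    exact CharTwo.add_self_eq_zero 1

/-- Hence **the virtual check's parity is the sum of the measured syndrome bits**.
[cite: KorteVygen2002, §12.2 Prop 12.6 (|V(C) ∩ T| is even)] -/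
theorem graphSyn_none_eq_sum (e : Q → ZMod 2) : graphSyn ι e none = ∑ r, graphSyn ι e (some r) := by
  have h := sum_graphSyn_eq_zero ι e
  rw [Fintype.sum_option] at h
  calc graphSyn ι e none
      = graphSyn ι e none + (∑ r, graphSyn ι e (some r) + ∑ r, graphSyn ι e (some r)) := by
        rw [CharTwo.add_self_eq_zero, add_zero]
    _ = ∑ r, graphSyn ι e (some r) := by rw [← add_assoc, h, zero_add]

/-- The **extended syndrome**: append to the measured bits the parity bit of the virtual boundary check.
(definition) [cite: DennisEtAl2002, §3.2 (defects paired with the boundary)] -/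
def extendSyn (s : R → ZMod 2) : Option R → ZMod 2 :=
  fun x => x.elim (∑ r, s r) s

/-- The extended syndrome of an error IS its extended boundary. [cite: KorteVygen2002, §12.2 Prop 12.6] -/
theorem extendSyn_mulVec (h : IsGraphlikeVia H ι) (e : Q → ZMod 2) : extendSyn (H *ᵥ e) = graphSyn ι e := by
  funext x
  cases x with
  | none =>
    simp only [extendSyn, Option.elim, graphSyn_none_eq_sum, mulVec_apply_eq_graphSyn_some h]
  | some r =>
    simp only [extendSyn, Option.elim, mulVec_apply_eq_graphSyn_some h]

/-- The undetectable errors of `H` are exactly the cycles of the extended graph. [cite: KorteVygen2002, §12.2 Prop 12.6] -/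
theorem mulVec_eq_zero_iff_mem_graphCycles (h : IsGraphlikeVia H ι) (x : Q → ZMod 2) :
    H *ᵥ x = 0 ↔ x ∈ graphCycles ι := by
  rw [graphCycles, Set.mem_setOf_eq, ← extendSyn_mulVec h]
  constructor
  · intro hx
    funext y
    cases y with
    | none => simp [extendSyn, hx]
    | some r => simp [extendSyn, hx]
  · intro hx
    funext r
    have := congrFun hx (some r)
    simpa [extendSyn] using this

/-- The **boundary decoder** induced by a decoder `D'` of the extended graph: feed it the extended syndrome.
(definition) [cite: DennisEtAl2002, §3.2 and §4.4 p. 18 (matching with the boundary)] -/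
def boundaryDecoder (D' : Decoder (Option R → ZMod 2) (Q → ZMod 2)) : Decoder (R → ZMod 2) (Q → ZMod 2) :=
  fun s => D' (extendSyn s)

/-- **MWPM with a virtual boundary check is minimum-weight decoding.** If `H` is graphlike with boundary via
`ι` and `D'` is a (minimum-weight perfect) matching decoder of the extended graph — any link metric on
`Option R`, any tie-break, any geodesics — then `boundaryDecoder D'` is a minimum-weight decoder for the sector
with check matrix `H`: `IsMinWeight (H *ᵥ ·) {x | H *ᵥ x = 0} hammingNorm` (Edmonds–Johnson on the extended
graph). [cite: KorteVygen2002, §12.2 Thm 12.9 (Edmonds and Johnson [1973])] -/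
theorem isMinWeight_boundaryDecoder [DecidableEq Q] (h : IsGraphlikeVia H ι) {m : EdgeMetric ι}
    {D' : Decoder (Option R → ZMod 2) (Q → ZMod 2)} (hD : IsMatchingDecoder m D') :
    (boundaryDecoder D').IsMinWeight (fun e => H *ᵥ e) {x | H *ᵥ x = 0} hammingNorm := by
  have hmw := hD.isMinWeight
  refine ⟨fun e => ?_, fun e => ?_⟩
  · show boundaryDecoder D' (H *ᵥ e) + e ∈ {x | H *ᵥ x = 0}
    rw [Set.mem_setOf_eq, mulVec_eq_zero_iff_mem_graphCycles h, boundaryDecoder, extendSyn_mulVec h]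
    exact hmw.add_mem e
  · show hammingNorm (boundaryDecoder D' (H *ᵥ e)) ≤ hammingNorm e
    rw [boundaryDecoder, extendSyn_mulVec h]
    exact hmw.weight_le e

/-! ### Every column-weight-`≤ 2` matrix is graphlike with boundary -/

/-- The column support of a binary matrix. (definition) [cite: KorteVygen2002, §12.2 Def 12.5 (δ(x))] -/
def colSupp (H : Matrix R Q (ZMod 2)) (q : Q) : Finset R :=
  univ.filter fun r => H r q ≠ 0

omit [Fintype Q] in
/-- **Column weight `≤ 2` ⇒ graphlike with boundary**: if every qubit is checked by at most two checks, some
link-end map `ι : Q → Sym2 (Option R)` presents `H` (two checks ↦ the pair; one check ↦ a link to the boundary;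
none ↦ a loop at the boundary). [cite: DennisEtAl2002, §3.2 (each link belongs to at most two sites / plaquettes)] -/
theorem exists_isGraphlikeVia_of_card_colSupp_le_two (H : Matrix R Q (ZMod 2))
    (hH : ∀ q, (colSupp H q).card ≤ 2) : ∃ ι : Q → Sym2 (Option R), IsGraphlikeVia H ι := by
  have h01 : ∀ y : ZMod 2, y ≠ 0 → y = 1 := by decide
  have key : ∀ q, ∃ p : Sym2 (Option R), ∀ r, H r q = pairIndicator p (some r) := by
    intro q
    have hmem : ∀ r, r ∈ colSupp H q ↔ H r q ≠ 0 := fun r => by simp [colSupp]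
    rcases Nat.lt_or_ge (colSupp H q).card 1 with h0 | h1
    · -- empty column: a loop at the boundary
      refine ⟨s(none, none), fun r => ?_⟩
      rw [pairIndicator_diag, Pi.zero_apply]
      by_contra hr
      have : r ∈ colSupp H q := (hmem r).2 hr
      have := card_pos.2 ⟨r, this⟩
      omega
    rcases Nat.lt_or_ge (colSupp H q).card 2 with h1' | h2
    · -- one check `a`: a link from `a` to the boundary
      obtain ⟨a, ha⟩ := card_eq_one.1 (by omega : (colSupp H q).card = 1)
      refine ⟨s(some a, none), fun r => ?_⟩
      rw [pairIndicator_apply (Option.some_ne_none a)]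
      by_cases hr : r = a
      · subst hr
        have : H r q ≠ 0 := (hmem r).1 (by rw [ha]; exact mem_singleton_self r)
        simp [h01 _ this]
      · have : ¬ H r q ≠ 0 := fun h => hr (by have := (hmem r).2 h; rw [ha, mem_singleton] at this; exact this)
        rw [not_not] at this
        simp [this, hr]
    · -- two checks `a ≠ b`
      obtain ⟨a, b, hab, hs⟩ := card_eq_two.1 (le_antisymm (hH q) h2)
      refine ⟨s(some a, some b), fun r => ?_⟩
      rw [pairIndicator_apply (fun h => hab (Option.some_injective _ h))]
      by_cases hr : r = a ∨ r = b
      · have : H r q ≠ 0 := (hmem r).1 (by rw [hs, mem_insert, mem_singleton]; exact hr)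
        rw [h01 _ this]
        rcases hr with rfl | rfl <;> simp
      · have hn : ¬ H r q ≠ 0 := fun h => hr (by
          have := (hmem r).2 h; rwa [hs, mem_insert, mem_singleton] at this)
        rw [not_not] at hn
        rw [not_or] at hr
        simp [hn, hr.1, hr.2]
  choose ι hι using key
  exact ⟨ι, fun r q => hι q r⟩

/-! ### `T` rounds of noisy measurement: the space-time matrix stays graphlike with boundary -/

/-- The **space-time lift** of a link-end map: a qubit fault `(v, t)` has the ends of `v` placed in slice `t`
(boundary stays boundary); a measurement fault `(c, t)` joins the space-time checks `(c, t)` and `(c, t+1)`.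
(definition) [cite: DennisEtAl2002, §4.2 (horizontal and vertical links of the space-time lattice)] -/
def stEndsOf (ι : Q → Sym2 (Option R)) (T : ℕ) : HistoryLoc Q R T → Sym2 (Option (R × Fin (T + 1))) :=
  Sum.elim (fun vt => (ι vt.1).map (Option.map fun r => (r, vt.2.castSucc)))
    (fun ct => s(some (ct.1, ct.2.castSucc), some (ct.1, ct.2.succ)))

omit [Fintype R] [Fintype Q] in
/-- **The space-time matrix of a graphlike-with-boundary check matrix is graphlike with boundary** (via the
space-time lift of its end map). [cite: DennisEtAl2002, §4.2–4.3 (∂ on the space-time lattice)] -/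
theorem isGraphlikeVia_stMatrix (h : IsGraphlikeVia H ι) (T : ℕ) :
    IsGraphlikeVia (CSSPhenom.stMatrix H T) (stEndsOf ι T) := by
  rintro ⟨c, τ⟩ ℓ
  rcases ℓ with ⟨v, t⟩ | ⟨c', t⟩
  · -- qubit fault in slice `t`
    simp only [CSSPhenom.stMatrix, of_apply, Sum.elim_inl, stEndsOf, h c v]
    induction ι v using Sym2.ind with
    | h x y =>
      rw [Sym2.map_mk, pairIndicator_mk, pairIndicator_mk, Pi.add_apply, Pi.add_apply, Pi.single_apply,
        Pi.single_apply, Pi.single_apply, Pi.single_apply]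
      cases x with
      | none =>
        cases y with
        | none => simp
        | some b =>
          by_cases hτ : τ = t.castSucc
          · subst hτ; by_cases hc : c = b <;> simp [hc]
          · simp [hτ]
      | some a =>
        cases y with
        | none =>
          by_cases hτ : τ = t.castSucc
          · subst hτ; by_cases hc : c = a <;> simp [hc]
          · simp [hτ]
        | some b =>
          by_cases hτ : τ = t.castSucc
          · subst hτ
            by_cases hca : c = a <;> by_cases hcb : c = b <;> simp [hca, hcb]
          · simp [hτ]
  · -- measurement fault between slices `t` and `t+1`
    simp only [CSSPhenom.stMatrix, of_apply, Sum.elim_inr, stEndsOf, pairIndicator_mk, Pi.add_apply,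
      Pi.single_apply]
    have hne : t.castSucc ≠ t.succ := Fin.castSucc_lt_succ.ne
    by_cases hc : c = c'
    · subst hc
      by_cases h1 : τ = t.castSucc
      · subst h1; simp [hne]
      · by_cases h2 : τ = t.succ
        · subst h2; simp [hne.symm]
        · simp [h1, h2]
    · simp [hc]

/-- **Space-time MWPM with a boundary is minimum-weight space-time decoding**: for `T` rounds of noisy
measurement of a graphlike-with-boundary sector `H`, every matching decoder of the extended space-time graph
induces a minimum-weight decoder for `CSSPhenom.stSyn H T` (the hypothesis of the tree's phenomenological-noise
threshold theorems for CSS sectors). [cite: DennisEtAl2002, §5.1 p. 19 (E_min on the space-time lattice by matching)] -/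
theorem isMinWeight_boundaryDecoder_st [DecidableEq Q] (h : IsGraphlikeVia H ι) (T : ℕ)
    {m : EdgeMetric (stEndsOf ι T)} {D' : Decoder (Option (R × Fin (T + 1)) → ZMod 2) (HistoryLoc Q R T → ZMod 2)}
    (hD : IsMatchingDecoder m D') :
    (boundaryDecoder D').IsMinWeight (CSSPhenom.stSyn H T) (CSSPhenom.stCycles H T) hammingNorm :=
  isMinWeight_boundaryDecoder (isGraphlikeVia_stMatrix h T) hD

end Boundary

end Literature.InformationTheory.QuantumCodes
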